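import Summits.AnomalousDissipation.AnomalousDissipation.Theorems.EnsembleRigidityGPTameDefectFloorParityForm3ToolsA
import Summits.AnomalousDissipation.AnomalousDissipation.Theorems.EnsembleRigidityGPTameDefectFloorParityForm3ToolsB
import Literature.Analysis.FluidPDE.EnergySpaceTorusProofs
import HarnessLib

/-!
# Stub `stub_gpTermwiseForm15` of line `Sketch` (crux stmt-AnomalousDissipation-17938, `EnsembleRigidity.GPTameDefectFloor`) — the `1/15` enstrophy certificate of `f_GP` (termwise-optimal general slot weights)

For the Galloway–Proctor force `f_GP = (sin 2πx₂, sin 2πx₀, sin 2πx₁)` on `T³` and every `v` in the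
energy space `H` with finite enstrophy `‖∇v‖² = Torus.eGradNormSq v < ∞` we prove
`∫ (v ⊗ v) : ∇f_GP = Torus.inertialPairing v f_GP ≥ -(1/15) ‖∇v‖²` (improving `7/100`,
`…ParityForm3.lean`); with `stub_linearFloor` this certifies the tame defect floor for all mean
enstrophies `G₁ < (3/2)/(1/15) = 45/2`.

Proof. The analytic layer `form3_pairing_ge_enstrophy` (`…ParityForm3ToolsB.lean`) for abstract slot
weights is fed with GENERAL weights (not ratios of a feature potential as in `…ParityForm3ToolsA`):
a SLOT is `(p, m)` (the coefficient `ûₘ(p)`), the terms of `I(u) = 2π Σⱼ Σₖ Re(conj ûⱼ(k - eⱼ) ûⱼ₊₁(k))`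
are the EDGES `(p, m) → (p + eₘ, m+1)`, a slot with `p ∥ eₘ` is a ZERO SLOT (`ûₘ(t eₘ) = 0` by
`û(0) = 0`, `k · û(k) = 0`) and edges through zero slots are dropped. A live edge `a → b` carries the
AM–GM weights `x` on `|û_a|²`, `1/x` on `|û_b|²`; every slot has at most one in- and one out-edge, so
the slot graph is a disjoint union of paths, the layer is a convex programme in `log x` with optimum
`c₀* = 0.066268…`, and `1/15` is met by the table below (`x(p, m) = N(p, m)/2000`, `114` non-unit
entries on `[-2, 2]³`, cyclically symmetric, slack `0.57 %`). The slot budgets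
`charge(p, m) ≤ (4π/15) |p|²` off the shell `|p|² = 2` and, on it, per-slot caps `Q` with the pooled
sums of the layer's symmetrised budget are ONE kernel `decide` over `[-3, 3]³` (`3.141592 < π`);
outside the box every weight is `≤ 4` and `8 ≤ (4π/15) · 16`. Everything but the `decide` is proved
for abstract tables. References: FMRT 2001, Ch. IV (the form `b`); Constantin–Foias 1988, Ch. 4 (4.33).
-/

-- `Summit.<Summit>.<Problem>` is the tree's mandated summit-side namespace (CONVENTIONS §2); single-conjunct summit, duplicate deliberate.
set_option linter.dupNamespace false

noncomputable section

namespace Summit.AnomalousDissipation.AnomalousDissipation.Theorems.EnsembleRigidity.GPTameDefectFloor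

open MeasureTheory Filter Topology UnitAddTorus
open scoped InnerProductSpace RealInnerProductSpace ENNReal NNReal
open Literature.Analysis.FunctionSpaces Literature.Analysis.FluidPDE
open Summit.AnomalousDissipation.AnomalousDissipation.Theorems.EnsembleRigidity

/-- Local notation: real vector fields on `T³`. -/
local notation "Vec3" => (UnitAddTorus (Fin 3)) → (EuclideanSpace ℝ (Fin 3))
/-- Local notation: `L²(T³; ℝ³)`. -/
local notation "L2" => (Lp (EuclideanSpace ℝ (Fin 3)) 2 (volume : Measure (UnitAddTorus (Fin 3))))
/-- Local notation: the energy space `H`. -/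
local notation "H3" => (Torus.energySpace (Fin 3))

/-! ## Slots, zero slots, the two tables, integer budgets (local notations; `N`, `Q` abstract) -/

/-- `|p|² = Σᵢ pᵢ² ∈ ℤ` for `p ∈ ℤ³`. -/
local notation "ν[" p "]" => (∑ i : Fin 3, (p : Fin 3 → ℤ) i ^ (2 : ℕ))
/-- The unit vectors `eₘ ∈ ℤ³`. -/
local notation "𝐞[" m "]" => (Pi.single (m : Fin 3) (1 : ℤ) : Fin 3 → ℤ)
set_option quotPrecheck false in
/-- Zero slots `(p, m)`: `p` supported on the axis `m` (`p = t eₘ`), where `ûₘ(p) = 0`. -/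
local notation "Z[" p ", " m "]" => (∀ i : Fin 3, i ≠ (m : Fin 3) → (p : Fin 3 → ℤ) i = 0)
set_option quotPrecheck false in
/-- Value of a table `N : ℤ³ × Fin 3 → ℕ` at the slot `(p, m)`. -/
local notation "A[" N ", " p ", " m "]" => ((N : ℤ → ℤ → ℤ → Fin 3 → ℕ) ((p : Fin 3 → ℤ) 0)
  ((p : Fin 3 → ℤ) 1) ((p : Fin 3 → ℤ) 2) (m : Fin 3))
set_option quotPrecheck false in
/-- Integer charge numerator of the slot `(p, m+1)` over the denominator `2000 · N(p - eₘ, m)`: the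
out-term `N(p, m+1)/2000` toward `(p + eₘ₊₁, m+2)` and the in-term `2000/N(p - eₘ, m)` from
`(p - eₘ, m)`, dead edges dropped. -/
local notation "X[" N ", " p ", " m "]" =>
  ((if Z[p + 𝐞[m + 1], m + 1 + 1] then (0 : ℤ) else ((A[N, p, m + 1] : ℕ) : ℤ)) *
      ((A[N, p - 𝐞[m], m] : ℕ) : ℤ) + (if Z[p - 𝐞[m], m] then (0 : ℤ) else 4000000))
set_option quotPrecheck false in
/-- Integer budget of the slot `(p, m+1)` with cap `κ` (units of `(4π/15)/1000`;
`8 · 3141592 = 25132736`, `3.141592 < π`). -/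
local notation "SB[" N ", " p ", " m ", " κ "]" =>
  (Z[p, m + 1] ∨ (15000000 : ℤ) * X[N, p, m] ≤ 25132736 * (κ : ℤ) * ((A[N, p - 𝐞[m], m] : ℕ) : ℤ))
set_option quotPrecheck false in
/-- Shell-`2` data of `p`: an out-of-plane index exists; the three slot budgets of `p` with the caps
`Q`; for the out-of-plane index `m`: `pₘ₊₁² = pₘ₊₂² = 1`, the caps of the slots `(±p, m)` total
`≤ 4000` and those of the four in-plane slots `(±p, m+1)`, `(±p, m+2)` total `≤ 8000`. -/
local notation "S2[" N ", " Q ", " p "]" =>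
  ((∃ m : Fin 3, (p : Fin 3 → ℤ) m = 0) ∧ (∀ i : Fin 3, SB[N, p, i, ((A[Q, p, i + 1] : ℕ) : ℤ)]) ∧
    ∀ m : Fin 3, (p : Fin 3 → ℤ) m = 0 →
      (p : Fin 3 → ℤ) (m + 1) ^ (2 : ℕ) = 1 ∧ (p : Fin 3 → ℤ) (m + 1 + 1) ^ (2 : ℕ) = 1 ∧
      A[Q, p, m] + A[Q, -p, m] ≤ 4000 ∧
      A[Q, p, m + 1] + A[Q, p, m + 1 + 1] + A[Q, -p, m + 1] + A[Q, -p, m + 1 + 1] ≤ 8000)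
set_option quotPrecheck false in
/-- All the integer budgets on the box `[-3, 3]³`. -/
local notation "BOX[" N ", " Q "]" =>
  (∀ p0 ∈ Finset.Icc (-3 : ℤ) 3, ∀ p1 ∈ Finset.Icc (-3 : ℤ) 3, ∀ p2 ∈ Finset.Icc (-3 : ℤ) 3,
    (ν[![p0, p1, p2]] = 2 → S2[N, Q, ![p0, p1, p2]]) ∧
    (ν[![p0, p1, p2]] = 0 ∨ ν[![p0, p1, p2]] = 2 ∨
      ∀ m : Fin 3, SB[N, ![p0, p1, p2], m, 1000 * ν[![p0, p1, p2]]]))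
set_option quotPrecheck false in
/-- The weight `α_N(p, m) = N(p, m)/2000` on the slot `(p, m)` against `(p + eₘ, m+1)` (`0` on a dead
edge). -/
local notation "wA[" N ", " p ", " m "]" =>
  (if Z[p, m] ∨ Z[p + 𝐞[m], m + 1] then (0 : ℝ) else ((A[N, p, m] : ℕ) : ℝ) / 2000)
set_option quotPrecheck false in
/-- The weight `β_N(p, m) = 2000/N(p - eₘ, m)` on the slot `(p, m+1)` against `(p - eₘ, m)` (`0` on a
dead edge). -/
local notation "wB[" N ", " p ", " m "]" =>
  (if Z[p, m + 1] ∨ Z[p - 𝐞[m], m] then (0 : ℝ) else 2000 / ((A[N, p - 𝐞[m], m] : ℕ) : ℝ))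
set_option quotPrecheck false in
/-- The `m = 0` slice `M(a, b, c)` of the numerator table (`38` non-unit entries on `[-2, 2]³`); by
the cyclic symmetry of `f_GP` the full table is `N(a, b, c, m) = M(σ⁻ᵐ(a, b, c))`,
`σ(a, b, c) = (c, a, b)`. -/
local notation "MM" =>
  (fun (a b c : ℤ) => (if a = -2 then (if b = -2 then (if c = 0 then 2278 else 2000) else if b =
  -1 then (if c = -1 then 7116 else if c = 0 then 7206 else if c = 1 then 7116 else 2000) else if
  b = 0 then (if c = -1 then 6571 else if c = 1 then 6571 else 2000) else if b = 1 then (if c = -1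
  then 2002 else if c = 0 then 7206 else if c = 1 then 2002 else 2000) else 2000) else if a = -1
  then (if b = -2 then (if c = -1 then 3569 else if c = 1 then 3569 else 2000) else if b = -1 then
  (if c = -1 then 4434 else if c = 1 then 3479 else 2000) else if b = 0 then (if c = -1 then 4803
  else if c = 1 then 4803 else if c = 2 then 1121 else 2000) else if b = 1 then (if c = -1 then
  4434 else if c = 1 then 3479 else 2000) else 2000) else if a = 0 then (if b = -2 then (if c = 0
  then 2278 else 2000) else if b = -1 then (if c = -1 then 2636 else if c = 0 then 833 else if c =
  1 then 2636 else if c = 2 then 1121 else 2000) else if b = 0 then (if c = -1 then 1665 else if c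
  = 1 then 1665 else 2000) else if b = 1 then (if c = -1 then 1015 else if c = 0 then 833 else if
  c = 1 then 1015 else if c = 2 then 1121 else 2000) else 2000) else if a = 1 then (if b = -1 then
  (if c = -1 then 1998 else if c = 0 then 555 else if c = 1 then 1057 else 2000) else if b = 0
  then (if c = -1 then 555 else if c = 1 then 555 else if c = 2 then 1121 else 2000) else if b = 1
  then (if c = -1 then 1998 else if c = 0 then 555 else if c = 1 then 1057 else 2000) else 2000)
  else 2000 : ℕ))
set_option quotPrecheck false in
/-- The numerator table `N` of the `1/15` certificate (`α(p, m) = N(p, m)/2000`): unit weights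
outside `[-2, 2]³`, the rotated slice `M` inside, clamped to `[500, 8000]`. -/
local notation "TT" => (fun (a b c : ℤ) (m : Fin 3) => max 500 (min 8000
  (if a < -2 ∨ 2 < a ∨ b < -2 ∨ 2 < b ∨ c < -2 ∨ 2 < c then (2000 : ℕ)
    else if m = 0 then MM a b c else if m = 1 then MM b c a else MM c a b)))
set_option quotPrecheck false in
/-- The `m = 0` slice of the cap table on the shell `|p|² = 2` (units of `(4π/15)/1000`). -/
local notation "C0" =>
  (fun (a b c : ℤ) => (if a = -1 then (if b = -1 then (if c = 0 then 539 else 0) else if b = 0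
  then (if c = -1 then 3198 else if c = 1 then 5733 else 0) else if b = 1 then (if c = 0 then 687
  else 0) else 0) else if a = 0 then (if b = -1 then (if c = -1 then 1937 else if c = 1 then 3008
  else 0) else if b = 1 then (if c = -1 then 970 else if c = 1 then 2040 else 0) else 0) else if a
  = 1 then (if b = -1 then (if c = 0 then 870 else 0) else if b = 0 then (if c = -1 then 663 else
  if c = 1 then 3198 else 0) else if b = 1 then (if c = 0 then 1018 else 0) else 0) else 0 : ℕ))
set_option quotPrecheck false in
/-- The cap table `Q(a, b, c, m) = C₀(σ⁻ᵐ(a, b, c))` of the shell `|p|² = 2`. -/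
local notation "QQ" => (fun (a b c : ℤ) (m : Fin 3) =>
  if m = 0 then C0 a b c else if m = 1 then C0 b c a else C0 c a b)

/-! ## The tables and their integer budgets (the only computations with the concrete tables) -/

/-- **All integer budgets of the tables `N`, `Q` on the box `[-3, 3]³`** (`990` slot budgets off the
shells `0, 2`, `36` capped slot budgets and `24` cap sums on the shell `2`), by kernel reduction. [folklore] -/
theorem termwise15_box : BOX[TT, QQ] := by
  decide +kernel

/-- The table `N` takes values in `[500, 8000]` (by its clamp). [folklore] -/
theorem termwise15_table : (∀ a b c m, 500 ≤ TT a b c m) ∧ (∀ a b c m, TT a b c m ≤ 8000) :=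
  ⟨fun a b c m => le_max_left _ _, fun a b c m => max_le (by norm_num) (min_le_left _ _)⟩

/-! ## Slot budgets for an abstract table -/

/-- `15·10⁶ X ≤ 8·3141592 κ d` gives `X/(2000 d) ≤ (4π/15) (κ/1000)` (`3.141592 < π`). [folklore] -/
theorem termwise15_arith {d : ℕ} {X κ : ℤ} (hd : 0 < d) (hκ : 0 ≤ κ)
    (h : 15000000 * X ≤ 25132736 * κ * d) :
    (X : ℝ) / (2000 * (d : ℝ)) ≤ 4 * Real.pi / 15 * ((κ : ℝ) / 1000) := by
  have hd' : (0 : ℝ) < d := by exact_mod_cast hd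
  have hκ' : (0 : ℝ) ≤ κ := by exact_mod_cast hκ
  have h' : (15000000 : ℝ) * X ≤ 25132736 * κ * d := by exact_mod_cast h
  rw [div_le_iff₀ (by positivity)]
  nlinarith [mul_nonneg (sub_nonneg.2 Real.pi_gt_d6.le) (mul_nonneg hκ' hd'.le)]

/-- The charge of a non-zero slot `(p, m+1)` is `X(p, m)/(2000 N(p - eₘ, m))`. [folklore] -/
theorem termwise15_charge (N : ℤ → ℤ → ℤ → Fin 3 → ℕ) (hN : ∀ a b c m, 0 < N a b c m)
    (p : Fin 3 → ℤ) (m : Fin 3) (hZ : ¬ Z[p, m + 1]) :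
    wA[N, p, m + 1] + wB[N, p, m] =
      ((X[N, p, m] : ℤ) : ℝ) / (2000 * ((A[N, p - 𝐞[m], m] : ℕ) : ℝ)) := by
  have hd : (0 : ℝ) < ((A[N, p - 𝐞[m], m] : ℕ) : ℝ) := by exact_mod_cast hN _ _ _ _
  have e1 : wA[N, p, m + 1] = (if Z[p + 𝐞[m + 1], m + 1 + 1] then (0 : ℝ)
      else ((A[N, p, m + 1] : ℕ) : ℝ)) / 2000 := by
    by_cases hA : Z[p + 𝐞[m + 1], m + 1 + 1]
    · rw [if_pos (Or.inr hA), if_pos hA, zero_div]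
    · rw [if_neg (fun h => h.elim hZ hA), if_neg hA]
  have e2 : wB[N, p, m] = (if Z[p - 𝐞[m], m] then (0 : ℝ) else 4000000) /
      (2000 * ((A[N, p - 𝐞[m], m] : ℕ) : ℝ)) := by
    by_cases hB : Z[p - 𝐞[m], m]
    · rw [if_pos (Or.inr hB), if_pos hB, zero_div]
    · rw [if_neg (fun h => h.elim hZ hB), if_neg hB, ← div_div]
      norm_num
  rw [e1, e2]
  simp only [Int.cast_add, Int.cast_mul, Int.cast_ite, Int.cast_zero, Int.cast_natCast,
    Int.cast_ofNat]
  field_simp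

/-- **Slot budget.** The integer budget `SB` of the slot `(p, m+1)` with cap `κ ≥ 0` gives the real
budget `α(p, m+1) + β(p, m) ≤ (4π/15) κ/1000` of its two weights. [folklore] -/
theorem termwise15_slot (N : ℤ → ℤ → ℤ → Fin 3 → ℕ) (hN : ∀ a b c m, 0 < N a b c m)
    (p : Fin 3 → ℤ) (m : Fin 3) {κ : ℤ} (hκ : 0 ≤ κ) (h : SB[N, p, m, κ]) :
    wA[N, p, m + 1] + wB[N, p, m] ≤ 4 * Real.pi / 15 * ((κ : ℝ) / 1000) := by
  by_cases hZ : Z[p, m + 1]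
  · have hκ' : (0 : ℝ) ≤ κ := by exact_mod_cast hκ
    rw [if_pos (Or.inl hZ), if_pos (Or.inl hZ), add_zero]
    positivity
  · rw [termwise15_charge N hN p m hZ]
    exact termwise15_arith (hN _ _ _ _) hκ (h.resolve_left hZ)

/-- The weights lie in `[0, 4]` for a table with values in `[500, 8000]`. [folklore] -/
theorem termwise15_wbound (N : ℤ → ℤ → ℤ → Fin 3 → ℕ) (hlo : ∀ a b c m, 500 ≤ N a b c m)
    (hhi : ∀ a b c m, N a b c m ≤ 8000) (p : Fin 3 → ℤ) (m : Fin 3) :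
    (0 ≤ wA[N, p, m] ∧ wA[N, p, m] ≤ 4) ∧ (0 ≤ wB[N, p, m] ∧ wB[N, p, m] ≤ 4) := by
  constructor
  · by_cases h : Z[p, m] ∨ Z[p + 𝐞[m], m + 1]
    · rw [if_pos h]; norm_num
    · rw [if_neg h]
      have h8 : ((A[N, p, m] : ℕ) : ℝ) ≤ 8000 := by exact_mod_cast hhi _ _ _ _
      exact ⟨by positivity, by rw [div_le_iff₀ (by norm_num)]; linarith⟩
  · by_cases h : Z[p, m + 1] ∨ Z[p - 𝐞[m], m]
    · rw [if_pos h]; norm_num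
    · rw [if_neg h]
      have h5 : (500 : ℝ) ≤ ((A[N, p - 𝐞[m], m] : ℕ) : ℝ) := by exact_mod_cast hlo _ _ _ _
      exact ⟨by positivity, by rw [div_le_iff₀ (by linarith)]; linarith⟩

/-- **Tail slots.** For `|p|² ≥ 16` the charge of any slot is `≤ 4 + 4 ≤ (4π/15) |p|²`. [folklore] -/
theorem termwise15_tail_slot (N : ℤ → ℤ → ℤ → Fin 3 → ℕ) (hlo : ∀ a b c m, 500 ≤ N a b c m)
    (hhi : ∀ a b c m, N a b c m ≤ 8000) (p : Fin 3 → ℤ) (h16 : 16 ≤ ν[p]) (m : Fin 3) :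
    wA[N, p, m + 1] + wB[N, p, m] ≤ 4 * Real.pi / 15 * ((ν[p] : ℤ) : ℝ) := by
  have h16' : (16 : ℝ) ≤ ((ν[p] : ℤ) : ℝ) := by exact_mod_cast h16
  nlinarith [(termwise15_wbound N hlo hhi p (m + 1)).1.2, (termwise15_wbound N hlo hhi p m).2.2,
    Real.pi_gt_d6]

/-- **Point budget** from the three slot budgets: `Σₘ (α(p,m)|cₘ|² + β(p,m)|cₘ₊₁|²) ≤ (4π/15) |p|² ‖c‖²`. [folklore] -/
theorem termwise15_point (N : ℤ → ℤ → ℤ → Fin 3 → ℕ) (p : Fin 3 → ℤ)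
    (hs : ∀ m : Fin 3, wA[N, p, m + 1] + wB[N, p, m] ≤ 4 * Real.pi / 15 * ((ν[p] : ℤ) : ℝ))
    (c : Fin 3 → ℂ) :
    ∑ m, (wA[N, p, m] * ‖c m‖ ^ 2 + wB[N, p, m] * ‖c (m + 1)‖ ^ 2) ≤
      4 * Real.pi / 15 * Torus.freqNormSq p * ∑ m, ‖c m‖ ^ 2 := by
  have h0 := mul_le_mul_of_nonneg_right (hs 0) (sq_nonneg ‖c (0 + 1)‖)
  have h1 := mul_le_mul_of_nonneg_right (hs 1) (sq_nonneg ‖c (1 + 1)‖)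
  have h2 := mul_le_mul_of_nonneg_right (hs 2) (sq_nonneg ‖c (2 + 1)‖)
  rw [form2_cast] at h0 h1 h2
  simp only [Fin.sum_univ_three, zero_add, form2_fin_succ] at h0 h1 h2 ⊢
  linarith

/-- A lattice point of the box `[-3, 3]³` satisfies `BOX`. [folklore] -/
theorem termwise15_box_at (N Q : ℤ → ℤ → ℤ → Fin 3 → ℕ) (hbox : BOX[N, Q]) (p : Fin 3 → ℤ)
    (hb : ∀ i, p i ∈ Finset.Icc (-3 : ℤ) 3) :
    (ν[p] = 2 → S2[N, Q, p]) ∧ (ν[p] = 0 ∨ ν[p] = 2 ∨ ∀ m : Fin 3, SB[N, p, m, 1000 * ν[p]]) := by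
  have hp : ![p 0, p 1, p 2] = p := by ext i; fin_cases i <;> rfl
  have h := hbox (p 0) (hb 0) (p 1) (hb 1) (p 2) (hb 2)
  rwa [hp] at h

/-- **The pointwise budget off the shells `0`, `2`** (tail slots outside the box, the table budgets
inside). [folklore] -/
theorem termwise15_hW4 (N Q : ℤ → ℤ → ℤ → Fin 3 → ℕ) (hlo : ∀ a b c m, 500 ≤ N a b c m)
    (hhi : ∀ a b c m, N a b c m ≤ 8000) (hbox : BOX[N, Q]) (p : Fin 3 → ℤ) (hp0 : p ≠ 0)
    (hp2 : Torus.freqNormSq p ≠ 2) (c : Fin 3 → ℂ) :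
    ∑ m, (wA[N, p, m] * ‖c m‖ ^ 2 + wB[N, p, m] * ‖c (m + 1)‖ ^ 2) ≤
      4 * Real.pi / 15 * Torus.freqNormSq p * ∑ m, ‖c m‖ ^ 2 := by
  have hN : ∀ a b c m, 0 < N a b c m := fun a b c m => lt_of_lt_of_le (by norm_num) (hlo a b c m)
  refine termwise15_point N p (fun m => ?_) c
  by_cases hb : ∀ i, p i ∈ Finset.Icc (-3 : ℤ) 3
  · obtain ⟨-, h⟩ := termwise15_box_at N Q hbox p hb
    rcases h with h | h | h
    · exact absurd (form2_eq_zero_of_normSq p h) hp0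
    · exact absurd (by rw [← form2_cast, h]; norm_num) hp2
    · have h1 := termwise15_slot N hN p m (by positivity) (h m)
      have e : (((1000 * ν[p] : ℤ)) : ℝ) / 1000 = ((ν[p] : ℤ) : ℝ) := by push_cast; ring
      rwa [e] at h1
  · obtain ⟨i, hi⟩ := not_forall.1 hb
    simp only [Finset.mem_Icc, not_and_or, not_le] at hi
    have hsq : p i ^ 2 ≤ ν[p] :=
      Finset.single_le_sum (f := fun i => p i ^ 2) (fun i _ => sq_nonneg (p i)) (Finset.mem_univ i)
    have h16 : 16 ≤ p i ^ 2 := by rcases hi with hi | hi <;> nlinarith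
    exact termwise15_tail_slot N hlo hhi p (h16.trans hsq) m

/-- **The symmetrised shell-`2` budget.** For `|p|² = 2` and transversal `c ⊥ p` the charges of the
six slots at `±p` total at most `2 · (4π/15) · 2 ‖c‖²`: with `m` the out-of-plane index,
`|c_{m+1}| = |c_{m+2}|` (from `p · c = 0`), each charge is at most its cap, caps pooled by `S2`. [folklore] -/
theorem termwise15_hW5 (N Q : ℤ → ℤ → ℤ → Fin 3 → ℕ) (hN : ∀ a b c m, 0 < N a b c m)
    (hbox : BOX[N, Q]) (p : Fin 3 → ℤ) (hp2 : Torus.freqNormSq p = 2) (c : Fin 3 → ℂ)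
    (hc : ∑ i, (p i : ℂ) * c i = 0) :
    ∑ m, (wA[N, p, m] * ‖c m‖ ^ 2 + wB[N, p, m] * ‖c (m + 1)‖ ^ 2) +
      ∑ m, (wA[N, -p, m] * ‖c m‖ ^ 2 + wB[N, -p, m] * ‖c (m + 1)‖ ^ 2) ≤
      2 * (4 * Real.pi / 15 * 2 * ∑ m, ‖c m‖ ^ 2) := by
  have hν : ν[p] = 2 := by exact_mod_cast (form2_cast p).trans hp2
  have hνn : ν[-p] = 2 := by simpa using hν
  have hb : ∀ q : Fin 3 → ℤ, ν[q] = 2 → ∀ i, q i ∈ Finset.Icc (-3 : ℤ) 3 := fun q hq i => by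
    have hi : q i ^ 2 ≤ ν[q] :=
      Finset.single_le_sum (f := fun i => q i ^ 2) (fun i _ => sq_nonneg (q i)) (Finset.mem_univ i)
    exact Finset.mem_Icc.2 ⟨by nlinarith, by nlinarith⟩
  obtain ⟨⟨m, hm⟩, hSp, hall⟩ := (termwise15_box_at N Q hbox p (hb p hν)).1 hν
  obtain ⟨-, hSn, -⟩ := (termwise15_box_at N Q hbox (-p) (hb (-p) hνn)).1 hνn
  obtain ⟨hs1, hs2, hout, hinn⟩ := hall m hm
  have B1 := termwise15_slot N hN p m (Nat.cast_nonneg _) (hSp m)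
  have B2 := termwise15_slot N hN p (m + 1) (Nat.cast_nonneg _) (hSp (m + 1))
  have B3 := termwise15_slot N hN p (m + 1 + 1) (Nat.cast_nonneg _) (hSp (m + 1 + 1))
  have B1' := termwise15_slot N hN (-p) m (Nat.cast_nonneg _) (hSn m)
  have B2' := termwise15_slot N hN (-p) (m + 1) (Nat.cast_nonneg _) (hSn (m + 1))
  have B3' := termwise15_slot N hN (-p) (m + 1 + 1) (Nat.cast_nonneg _) (hSn (m + 1 + 1))
  have hout' : (((A[Q, p, m] : ℕ) : ℤ) : ℝ) + (((A[Q, -p, m] : ℕ) : ℤ) : ℝ) ≤ 4000 := by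
    exact_mod_cast hout
  have hinn' : (((A[Q, p, m + 1] : ℕ) : ℤ) : ℝ) + (((A[Q, p, m + 1 + 1] : ℕ) : ℤ) : ℝ) +
      (((A[Q, -p, m + 1] : ℕ) : ℤ) : ℝ) + (((A[Q, -p, m + 1 + 1] : ℕ) : ℤ) : ℝ) ≤ 8000 := by
    exact_mod_cast hinn
  have hc' : (p (m + 1) : ℂ) * c (m + 1) + (p (m + 1 + 1) : ℂ) * c (m + 1 + 1) = 0 := by
    rw [form3_sum3 (fun i => (p i : ℂ) * c i) m] at hc
    simpa only [hm, Int.cast_zero, zero_mul, zero_add] using hc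
  have tie : ‖c (m + 1)‖ ^ 2 = ‖c (m + 1 + 1)‖ ^ 2 := by
    have h1 := congrArg (fun z : ℂ => ‖z‖ ^ 2) (eq_neg_of_add_eq_zero_left hc')
    simp only [norm_neg, norm_mul, mul_pow, Complex.norm_intCast, sq_abs] at h1
    have e1 : ((p (m + 1) : ℤ) : ℝ) ^ 2 = 1 := by exact_mod_cast hs1
    have e2 : ((p (m + 1 + 1) : ℤ) : ℝ) ^ 2 = 1 := by exact_mod_cast hs2
    rw [e1, e2, one_mul, one_mul] at h1
    exact h1
  rw [form3_sum3 (fun i => wA[N, p, i] * ‖c i‖ ^ 2 + wB[N, p, i] * ‖c (i + 1)‖ ^ 2) m,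
    form3_sum3 (fun i => wA[N, -p, i] * ‖c i‖ ^ 2 + wB[N, -p, i] * ‖c (i + 1)‖ ^ 2) m,
    form3_sum3 (fun i => ‖c i‖ ^ 2) m]
  simp only [form3_add3] at B2 B2' B3 B3' ⊢
  rw [tie]
  have hK : (0 : ℝ) ≤ 4 * Real.pi / 15 / 1000 := by positivity
  linarith [mul_le_mul_of_nonneg_right B1 (sq_nonneg ‖c (m + 1 + 1)‖),
    mul_le_mul_of_nonneg_right B2 (sq_nonneg ‖c (m + 1 + 1)‖),
    mul_le_mul_of_nonneg_right B3 (sq_nonneg ‖c m‖),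
    mul_le_mul_of_nonneg_right B1' (sq_nonneg ‖c (m + 1 + 1)‖),
    mul_le_mul_of_nonneg_right B2' (sq_nonneg ‖c (m + 1 + 1)‖),
    mul_le_mul_of_nonneg_right B3' (sq_nonneg ‖c m‖),
    mul_le_mul_of_nonneg_left hout' (mul_nonneg hK (sq_nonneg ‖c m‖)),
    mul_le_mul_of_nonneg_left hinn' (mul_nonneg hK (sq_nonneg ‖c (m + 1 + 1)‖))]

/-! ## Live edges, packaged weights, the certificate -/

/-- **Live edges**: along `(k - eⱼ, j) → (k, j+1)` an end is a zero slot or `α β = (N/2000)(2000/N) = 1`. [folklore] -/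
theorem termwise15_edge (N : ℤ → ℤ → ℤ → Fin 3 → ℕ) (hN : ∀ a b c m, 0 < N a b c m)
    (k : Fin 3 → ℤ) (j : Fin 3) :
    Z[k - 𝐞[j], j] ∨ Z[k, j + 1] ∨ 1 ≤ wA[N, k - 𝐞[j], j] * wB[N, k, j] := by
  by_cases h1 : Z[k - 𝐞[j], j]
  · exact Or.inl h1
  by_cases h2 : Z[k, j + 1]
  · exact Or.inr (Or.inl h2)
  refine Or.inr (Or.inr (le_of_eq ?_))
  simp only [sub_add_cancel]
  have ha : (0 : ℝ) < ((A[N, k - 𝐞[j], j] : ℕ) : ℝ) := by exact_mod_cast hN _ _ _ _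
  rw [if_neg (fun h => h.elim h1 h2), if_neg (fun h => h.elim h2 h1), div_mul_div_comm, mul_comm,
    div_self (by positivity)]

/-- Packaging, for abstract tables `N` (values in `[500, 8000]`) and `Q` with all box budgets: the
weights `α_N`, `β_N` have the seven properties consumed by `form3_pairing_ge_enstrophy`. [folklore] -/
theorem termwise15_weight_exists_of (N Q : ℤ → ℤ → ℤ → Fin 3 → ℕ)
    (hlo : ∀ a b c m, 500 ≤ N a b c m) (hhi : ∀ a b c m, N a b c m ≤ 8000) (hbox : BOX[N, Q]) :
    ∃ α β : (Fin 3 → ℤ) → Fin 3 → ℝ,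
    (∀ p m, 0 ≤ α p m) ∧ (∀ p m, 0 ≤ β p m) ∧ (∀ p m, α p m ≤ 4) ∧ (∀ p m, β p m ≤ 4) ∧
    (∀ (k : Fin 3 → ℤ) (j : Fin 3), (∀ i, i ≠ j → (k - Pi.single j 1 : Fin 3 → ℤ) i = 0) ∨
      (∀ i, i ≠ j + 1 → k i = 0) ∨ 1 ≤ α (k - Pi.single j 1) j * β k j) ∧
    (∀ p : Fin 3 → ℤ, p ≠ 0 → Torus.freqNormSq p ≠ 2 → ∀ c : Fin 3 → ℂ,
      ∑ m, (α p m * ‖c m‖ ^ 2 + β p m * ‖c (m + 1)‖ ^ 2) ≤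
        4 * Real.pi / 15 * Torus.freqNormSq p * ∑ m, ‖c m‖ ^ 2) ∧
    (∀ p : Fin 3 → ℤ, Torus.freqNormSq p = 2 → ∀ c : Fin 3 → ℂ, ∑ i, (p i : ℂ) * c i = 0 →
      ∑ m, (α p m * ‖c m‖ ^ 2 + β p m * ‖c (m + 1)‖ ^ 2) +
        ∑ m, (α (-p) m * ‖c m‖ ^ 2 + β (-p) m * ‖c (m + 1)‖ ^ 2) ≤
        2 * (4 * Real.pi / 15 * 2 * ∑ m, ‖c m‖ ^ 2)) := by
  have hN : ∀ a b c m, 0 < N a b c m := fun a b c m => lt_of_lt_of_le (by norm_num) (hlo a b c m)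
  exact ⟨fun p m => wA[N, p, m], fun p m => wB[N, p, m],
    fun p m => (termwise15_wbound N hlo hhi p m).1.1, fun p m => (termwise15_wbound N hlo hhi p m).2.1,
    fun p m => (termwise15_wbound N hlo hhi p m).1.2, fun p m => (termwise15_wbound N hlo hhi p m).2.2,
    termwise15_edge N hN, termwise15_hW4 N Q hlo hhi hbox, termwise15_hW5 N Q hN hbox⟩

/-- **The `1/15` bound on `L²` fields with vanishing zero mode and transversal coefficients**: for
`u ∈ L²(T³; ℝ³)` with `û(0) = 0`, `k · û(k) = 0` for all `k` and `‖∇u‖² < ∞`,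
`∫ ⟪∇f_GP u, u⟫ ≥ -(1/15) ‖∇u‖²` — the analytic layer (`form3_pairing_ge_enstrophy`, `K = 4π/15`,
`K/(4π) = 1/15`) fed with the slot weights of the tables `N`, `Q`. [folklore] -/
theorem termwise15_pairing_ge_enstrophy_gp {u : Vec3} (hu : MemLp u 2 volume)
    (hU0 : mFourierCoeff (EuclideanSpace.complexify ∘ u) 0 = 0)
    (hdiv : ∀ k : Fin 3 → ℤ,
      ∑ j, (k j : ℂ) * mFourierCoeff (EuclideanSpace.complexify ∘ u) k j = 0)
    (hfin : Torus.eGradNormSq u ≠ ⊤) :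
    -(1 / 15 * (Torus.eGradNormSq u).toReal) ≤ ∫ x, ⟪Torus.fderiv gpForce x (u x), u x⟫_ℝ := by
  obtain ⟨α, β, hα, hβ, hαC, hβC, hedge, hW4, hW5⟩ :=
    termwise15_weight_exists_of TT QQ termwise15_table.1 termwise15_table.2 termwise15_box
  have h := form3_pairing_ge_enstrophy α β (4 * Real.pi / 15) 4 hα hβ hαC hβC hedge hW4 hW5 hu
    hU0 hdiv hfin
  have e : 4 * Real.pi / 15 / (4 * Real.pi) = 1 / 15 := by
    have hπ := Real.pi_pos
    field_simp
  rwa [e] at h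

/-! ## The stub -/

/-- **Stub `stub_gpTermwiseForm15`** (enstrophy axis) — TERMWISE-OPTIMAL GENERAL SLOT WEIGHTS. For
every `v` in the energy space `H` of `T³` with finite enstrophy, `∫ (v ⊗ v) : ∇f_GP ≥ -(1/15) ‖∇v‖²`:
the landed analytic layer `form3_pairing_ge_enstrophy` fed with general AM–GM weights on the live
edges of the slot graph of `f_GP` (a disjoint union of paths, on which the layer's optimum
`c₀* = 0.066268…` is computable exactly; `1/15` is met with slack `0.57 %` by a cyclically symmetric
table of `114` rational weights), certified by one kernel `decide` over `[-3, 3]³`. Certifies the tame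
defect floor up to mean enstrophy `G₁ < 45/2`. [folklore] -/
theorem stub_gpTermwiseForm15 : ∀ v : H3, Torus.eGradNormSq ((v : L2) : Vec3) ≠ ⊤ → -(1 / 15 * (Torus.eGradNormSq ((v : L2) : Vec3)).toReal) ≤ Torus.inertialPairing (v : L2) gpForce := by
  intro v hv
  rw [Torus.inertialPairing]
  have hmem := (Torus.mem_energySpace_iff_holds (v : L2)).1 v.2
  exact termwise15_pairing_ge_enstrophy_gp (Lp.memLp (v : L2))
    (Torus.mFourierCoeff_complexify_coe_zero_of_mem v.2)
    (Torus.IsWeaklyDivFree.sum_mul_mFourierCoeff_eq_zero (Lp.memLp (v : L2)) hmem.1) hv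

end Summit.AnomalousDissipation.AnomalousDissipation.Theorems.EnsembleRigidity.GPTameDefectFloor

end
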